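import Summits.NavierStokesRegularity.NavierStokesRegularity.Theses.QuantisedSymmetry
import Summits.NavierStokesRegularity.NavierStokesRegularity.Theses.Blowup
import Summits.NavierStokesRegularity.NavierStokesRegularity.Theses.FilamentSkeletonRss
import Summits.NavierStokesRegularity.NavierStokesRegularity.Theorems.QuantisedSymmetryPolyhedralTruncationBridge
import Summits.NavierStokesRegularity.NavierStokesRegularity.Theorems.FilamentSkeletonRssRdssProfileTruncation
import Summits.NavierStokesRegularity.NavierStokesRegularity.Theorems.QuantisedSymmetryLiouvilleKillsProfile
import Summits.NavierStokesRegularity.NavierStokesRegularity.Theorems.QuantisedSymmetryPolyhedralDssProfileExistsOfCell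
import Summits.NavierStokesRegularity.NavierStokesRegularity.Theorems.QuantisedSymmetryPolyhedralDssProfileExistsCellOfProfile
import Summits.NavierStokesRegularity.NavierStokesRegularity.Theorems.QuantisedSymmetryPolyhedralDssProfileExistsDominatesBlowupProfile
import Summits.NavierStokesRegularity.NavierStokesRegularity.Theorems.QuantisedSymmetryPolyhedralDssProfileExistsStubPeriodWindow
import Summits.NavierStokesRegularity.NavierStokesRegularity.Theorems.QuantisedSymmetryPolyhedralDssProfileExistsStubNoSmallConstant
import Literature.Analysis.FluidPDE.SelfSimilar
import HarnessLib

/-!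
# Strategist sketch s19-g2 (independent census family `s`, gen 2) for the crux
`QuantisedSymmetry.PolyhedralDssProfileExists` (stmt-NavierStokesRegularity-1404)

Typed companion of `STRATEGY-CENSUS-s19.md`.  Everything here is kernel-checked (no `sorry`):

* §1 `crux_decides` — the crux ALONE proves `¬ NavierStokesRegularity` (all co-binders of the route's
  `closes` are landed), i.e. the crux is at least summit-strength on the negative side.
* §2 weaker intermediates read off the summit statement: the symmetry-free profile `PlainDssProfileExists`
  (W1) and blow-up existence `Blowup.BlowupExists` (X5a) — both still decide the summit through LANDED
  bridges, so neither is "short of the summit"; the negated kill switch `¬ PolyhedralTypeILiouville` (W3)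
  is strictly weaker-looking but has no bridge to the summit.
* §3 the crux with its parameters exposed and the natural STRENGTHENINGS refuted by tree theorems
  (small Type-I constant, factor near 1, λ-continuous = steady profiles).
* §4 two honest typed DECOMPOSITIONS with proved assemblies: compactness split
  `ApproxCells → CompactnessClosure → Crux` and certificate split
  `CertifiedApproximateProfile → QuadraticNK → Crux`; in each the first piece carries the whole crux.
-/

set_option linter.dupNamespace false
set_option linter.unusedVariables false

noncomputable section

namespace Summit.NavierStokesRegularity.NavierStokesRegularity.Cruxes.PolyhedralDssProfileExists.StrategistS19g2

open MeasureTheory Set Function Filter Topology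
open Literature.Analysis.FluidPDE

/-- `ℝ³` as used by the route. -/
abbrev E3 : Type := EuclideanSpace ℝ (Fin 3)

/-- The crux, by name. -/
abbrev Crux : Prop :=
  _root_.Summit.NavierStokesRegularity.NavierStokesRegularity.Theses.QuantisedSymmetry.PolyhedralDssProfileExists

/-! ## §1  Summit strength: the crux alone decides the summit (negatively) -/

/-- The crux alone refutes Clay (A): the other two binders of the route's deciding theorem are tree
theorems (`quantisedSymmetry_polyhedralTruncationBridge_proof`, `ClayUniqueness_holds`). -/
theorem crux_decides (h : Crux) : ¬ _root_.NavierStokesRegularity :=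
  _root_.Summit.NavierStokesRegularity.NavierStokesRegularity.Theses.QuantisedSymmetry.closes h
    _root_.Summit.NavierStokesRegularity.NavierStokesRegularity.Theorems.quantisedSymmetry_polyhedralTruncationBridge_proof
    _root_.Summit.NavierStokesRegularity.NavierStokesRegularity.Theses.QuantisedSymmetry.ClayUniqueness_holds

/-! ## §2  Weaker intermediates read off the summit statement -/

/-- **W1** — the symmetry-free Type-I DSS profile (the crux with the group clauses deleted; literally the
antecedent of `FilamentSkeletonRss.RdssProfileTruncation` at the trivial rotation). -/
def PlainDssProfileExists : Prop :=
  ∃ c : ℝ, 1 < c ∧ ∃ u : ℝ → E3 → E3,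
    IsAncientMildSolution 1 u ∧ (∀ t < 0, AEStronglyMeasurable (u t) volume) ∧
    IsDiscretelySelfSimilar c u ∧ (∃ C₀ : ℝ, HasTypeIDecay C₀ u) ∧ ¬ (∀ t < 0, u t =ᵐ[volume] 0)

theorem plain_of_crux (h : Crux) : PlainDssProfileExists := by
  obtain ⟨G, -, -, -, c, hc, u, hanc, hmeas, hdss, hdec, -, hnt⟩ := h
  exact ⟨c, hc, u, hanc, hmeas, hdss, hdec, hnt⟩

/-- **X5a** follows from W1 by the LANDED symmetry-free truncation bridge. -/
theorem x5a_of_plain (h : PlainDssProfileExists) :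
    _root_.Summit.NavierStokesRegularity.NavierStokesRegularity.Theses.Blowup.BlowupExists := by
  obtain ⟨c, hc, u, hanc, hmeas, hdss, hdec, hnt⟩ := h
  exact _root_.Summit.NavierStokesRegularity.NavierStokesRegularity.Theorems.filamentSkeletonRss_rdssProfileTruncation_proof
    ⟨c, LinearIsometryEquiv.refl ℝ E3, u, hc, hanc, hmeas, isRotatedDSS_refl_iff.mpr hdss, hdec, hnt⟩

/-- **X5a decides** (route `Blowup`'s deciding theorem with its uniqueness binder landed). -/
theorem x5a_decides
    (h : _root_.Summit.NavierStokesRegularity.NavierStokesRegularity.Theses.Blowup.BlowupExists) :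
    ¬ _root_.NavierStokesRegularity :=
  _root_.Summit.NavierStokesRegularity.NavierStokesRegularity.Theses.Blowup.closes h
    _root_.Summit.NavierStokesRegularity.NavierStokesRegularity.Theses.Blowup.BlowupClayUniqueness_holds

/-- Hence **W1 decides** too: dropping the polyhedral symmetry does not move the crux below the summit. -/
theorem plain_decides (h : PlainDssProfileExists) : ¬ _root_.NavierStokesRegularity :=
  x5a_decides (x5a_of_plain h)

/-- **W3** — the negated kill switch is implied by the crux (landed `LiouvilleKillsProfile`); it has no
bridge to the summit (a non-DSS Type-I ancient solution yields only a LOCAL Type-I singularity,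
Albritton–Barker 2019 Thm 1.1). -/
theorem not_polyhedralLiouville_of_crux (h : Crux) :
    ¬ _root_.Summit.NavierStokesRegularity.NavierStokesRegularity.Theses.QuantisedSymmetry.PolyhedralTypeILiouville := by
  intro hL
  have hk := _root_.Summit.NavierStokesRegularity.NavierStokesRegularity.Theorems.quantisedSymmetry_liouvilleKillsProfile_proof
  unfold _root_.Summit.NavierStokesRegularity.NavierStokesRegularity.Theses.QuantisedSymmetry.LiouvilleKillsProfile at hk
  exact hk hL h

/-- **W1'** — the crux dominates route `Blowup`'s profile crux (stmt-0155), landed. -/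
theorem blowupProfile_of_crux (h : Crux) :
    _root_.Summit.NavierStokesRegularity.NavierStokesRegularity.Theses.Blowup.BlowupTypeIDssProfile :=
  _root_.Summit.NavierStokesRegularity.NavierStokesRegularity.Theorems.PolyhedralDssProfileExists.PolyhedralCell.stub_dominatesBlowupProfile h

/-! ## §3  Parameters exposed; strengthenings refuted by tree theorems -/

/-- The crux at factor `c` and Type-I constant `C₀`. -/
def CruxAt (c C₀ : ℝ) : Prop :=
  ∃ G : Subgroup (E3 ≃ₗᵢ[ℝ] E3), Finite G ∧
    (∀ g ∈ G, LinearMap.det (g.toLinearEquiv : E3 →ₗ[ℝ] E3) = 1) ∧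
    (∀ V : Submodule ℝ E3, (∀ g ∈ G, ∀ v ∈ V, g v ∈ V) → V = ⊥ ∨ V = ⊤) ∧
    ∃ u : ℝ → E3 → E3, IsAncientMildSolution 1 u ∧ (∀ t < 0, AEStronglyMeasurable (u t) volume) ∧
      IsDiscretelySelfSimilar c u ∧ HasTypeIDecay C₀ u ∧ (∀ g ∈ G, ∀ t x, u t (g x) = g (u t x)) ∧
      ¬ (∀ t < 0, u t =ᵐ[volume] 0)

theorem crux_iff_exists_cruxAt : Crux ↔ ∃ c C₀ : ℝ, 1 < c ∧ CruxAt c C₀ := by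
  constructor
  · rintro ⟨G, hfin, hdet, hirr, c, hc, u, hanc, hmeas, hdss, ⟨C₀, hdec⟩, heqv, hnt⟩
    exact ⟨c, C₀, hc, G, hfin, hdet, hirr, u, hanc, hmeas, hdss, hdec, heqv, hnt⟩
  · rintro ⟨c, C₀, hc, G, hfin, hdet, hirr, u, hanc, hmeas, hdss, hdec, heqv, hnt⟩
    exact ⟨G, hfin, hdet, hirr, c, hc, u, hanc, hmeas, hdss, ⟨C₀, hdec⟩, heqv, hnt⟩

/-- **S⁺(small amplitude) is refuted**: below an absolute Type-I constant there is no profile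
(ε-regularity; landed `stub_noSmallConstant`). -/
theorem not_cruxAt_of_small_constant : ∃ ε : ℝ, 0 < ε ∧ ∀ c C₀ : ℝ, C₀ ≤ ε → ¬ CruxAt c C₀ := by
  obtain ⟨ε, hε, h⟩ :=
    _root_.Summit.NavierStokesRegularity.NavierStokesRegularity.Theorems.PolyhedralDssProfileExists.PolyhedralCell.stub_noSmallConstant
  refine ⟨ε, hε, fun c C₀ hle hX => ?_⟩
  obtain ⟨G, -, -, -, u, hanc, hmeas, -, hdec, -, hnt⟩ := hX
  exact hnt (h u C₀ hanc hmeas hdec hle)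

/-- **S⁺(factor near 1) is refuted**: for each Type-I constant the factors in a window `(1, c₁(C₀))` carry
no profile (Chae–Wolf 2017 Thm 1.3; landed `stub_periodWindow`). -/
theorem not_cruxAt_of_factor_near_one :
    ∀ C₀ : ℝ, 0 < C₀ → ∃ c₁ : ℝ, 1 < c₁ ∧ ∀ c : ℝ, 1 < c → c < c₁ → ¬ CruxAt c C₀ := by
  intro C₀ hC₀
  obtain ⟨c₁, hc₁, h⟩ :=
    _root_.Summit.NavierStokesRegularity.NavierStokesRegularity.Theorems.PolyhedralDssProfileExists.PolyhedralCell.stub_periodWindow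
      C₀ hC₀
  refine ⟨c₁, hc₁, fun c hc hcc hX => ?_⟩
  obtain ⟨G, -, -, -, u, hanc, hmeas, hdss, hdec, -, hnt⟩ := hX
  exact hnt (h c u hc hcc hanc hmeas hdss hdec)

/-- **S⁺(steady / λ-continuous)**: the crux with discrete self-similarity strengthened to self-similarity
at every factor. -/
def SteadyCrux : Prop :=
  ∃ G : Subgroup (E3 ≃ₗᵢ[ℝ] E3), Finite G ∧
    (∀ g ∈ G, LinearMap.det (g.toLinearEquiv : E3 →ₗ[ℝ] E3) = 1) ∧
    (∀ V : Submodule ℝ E3, (∀ g ∈ G, ∀ v ∈ V, g v ∈ V) → V = ⊥ ∨ V = ⊤) ∧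
    ∃ u : ℝ → E3 → E3, IsAncientMildSolution 1 u ∧ (∀ t < 0, AEStronglyMeasurable (u t) volume) ∧
      (∀ c : ℝ, 1 < c → IsDiscretelySelfSimilar c u) ∧ (∃ C₀ : ℝ, HasTypeIDecay C₀ u) ∧
      (∀ g ∈ G, ∀ t x, u t (g x) = g (u t x)) ∧ ¬ (∀ t < 0, u t =ᵐ[volume] 0)

/-- **S⁺(steady) is refuted** in the crux's own class, from the two landed removals (this is the
Nečas–Růžička–Šverák / Tsai exclusion, re-derived: a λ-continuous profile is `c`-DSS for `c` inside the
Chae–Wolf window). -/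
theorem not_steadyCrux : ¬ SteadyCrux := by
  rintro ⟨G, -, -, -, u, hanc, hmeas, hss, ⟨C₀, hdec⟩, -, hnt⟩
  obtain ⟨ε, hε, hsmall⟩ :=
    _root_.Summit.NavierStokesRegularity.NavierStokesRegularity.Theorems.PolyhedralDssProfileExists.PolyhedralCell.stub_noSmallConstant
  by_cases hC : C₀ ≤ ε
  · exact hnt (hsmall u C₀ hanc hmeas hdec hC)
  · have hC₀ : 0 < C₀ := hε.trans (not_le.mp hC)
    obtain ⟨c₁, hc₁, h⟩ :=
      _root_.Summit.NavierStokesRegularity.NavierStokesRegularity.Theorems.PolyhedralDssProfileExists.PolyhedralCell.stub_periodWindow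
        C₀ hC₀
    have h1 : (1 : ℝ) < (1 + c₁) / 2 := by linarith
    have h2 : (1 + c₁) / 2 < c₁ := by linarith
    exact hnt (h _ u h1 h2 hanc hmeas (hss _ h1) hdec)

/-! ## §4  Decompositions with proved assemblies -/

/-- The polyhedral CELL (the registered ∃-stub of line `polyhedral_cell`, certified `↔` the crux in the
tree: `stub_profileOfPolyhedralCell`, `stub_cellOfProfile`). -/
def PolyhedralCell : Prop :=
  ∃ G : Subgroup (E3 ≃ₗᵢ[ℝ] E3), Finite G ∧
    (∀ g ∈ G, LinearMap.det (g.toLinearEquiv : E3 →ₗ[ℝ] E3) = 1) ∧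
    (∀ V : Submodule ℝ E3, (∀ g ∈ G, ∀ v ∈ V, g v ∈ V) → V = ⊥ ∨ V = ⊤) ∧
    ∃ c : ℝ, 1 < c ∧ ∃ v : ℝ → E3 → E3,
      (ContinuousOn (Function.uncurry v) (Set.Icc (-1 : ℝ) (-(c ^ 2)⁻¹) ×ˢ Set.univ) ∧
        (∃ M : ℝ, ∀ t ∈ Set.Icc (-1 : ℝ) (-(c ^ 2)⁻¹), ∀ x, ‖v t x‖ ≤ M) ∧
        (∀ t ∈ Set.Icc (-1 : ℝ) (-(c ^ 2)⁻¹), IsWeaklyDivFree (v t)) ∧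
        (∀ s t : ℝ, -1 ≤ s → s < t → t ≤ -(c ^ 2)⁻¹ → ∀ x,
          v t x = heatFlow (v s) (t - s) x - oseenDuhamel 1 s v v t x) ∧
        (∀ x, v (-(c ^ 2)⁻¹) x = c • v (-1) (c • x)) ∧
        (∀ g ∈ G, ∀ t ∈ Set.Icc (-1 : ℝ) (-(c ^ 2)⁻¹), ∀ x, v t (g x) = g (v t x))) ∧
      MemLp (v (-1)) 4 volume ∧ ¬ (v (-1) =ᵐ[volume] 0)

theorem crux_iff_cell : Crux ↔ PolyhedralCell :=
  ⟨_root_.Summit.NavierStokesRegularity.NavierStokesRegularity.Theorems.PolyhedralDssProfileExists.PolyhedralCell.stub_cellOfProfile,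
   _root_.Summit.NavierStokesRegularity.NavierStokesRegularity.Theorems.PolyhedralDssProfileExists.PolyhedralCell.stub_profileOfPolyhedralCell⟩

/-- **Split A, piece 1 (open; carries the crux): uniformly controlled APPROXIMATE polyhedral cells at every
accuracy.**  For fixed constants (Lipschitz/amplitude/`L⁴` bound `M₀`, factor window `[c₋, c₊] ⊂ (1,∞)`,
floor `δ₀ > 0` at radius `≤ R₀`), every `ε > 0` admits a `G`-equivariant, weakly solenoidal, zoom-closing
field on the model period whose Oseen-mildness DEFECT is `≤ ε` pointwise.  (Galerkin / harmonic-balance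
/ Newton–Krylov outputs with a posteriori residual bounds would be such objects.) -/
def ApproxCells : Prop :=
  ∃ (M₀ R₀ δ₀ cm cM : ℝ), 0 < δ₀ ∧ 1 < cm ∧ ∀ ε : ℝ, 0 < ε →
    ∃ G : Subgroup (E3 ≃ₗᵢ[ℝ] E3), Finite G ∧
      (∀ g ∈ G, LinearMap.det (g.toLinearEquiv : E3 →ₗ[ℝ] E3) = 1) ∧
      (∀ V : Submodule ℝ E3, (∀ g ∈ G, ∀ v ∈ V, g v ∈ V) → V = ⊥ ∨ V = ⊤) ∧
      ∃ c : ℝ, cm ≤ c ∧ c ≤ cM ∧ ∃ v : ℝ → E3 → E3,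
        (∀ p ∈ Set.Icc (-1 : ℝ) (-(c ^ 2)⁻¹) ×ˢ (Set.univ : Set E3),
          ∀ q ∈ Set.Icc (-1 : ℝ) (-(c ^ 2)⁻¹) ×ˢ (Set.univ : Set E3),
            ‖Function.uncurry v p - Function.uncurry v q‖ ≤ M₀ * dist p q) ∧
        (∀ t ∈ Set.Icc (-1 : ℝ) (-(c ^ 2)⁻¹), ∀ x, ‖v t x‖ ≤ M₀) ∧
        (∀ t ∈ Set.Icc (-1 : ℝ) (-(c ^ 2)⁻¹), IsWeaklyDivFree (v t)) ∧
        (∀ s t : ℝ, -1 ≤ s → s < t → t ≤ -(c ^ 2)⁻¹ → ∀ x,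
          ‖v t x - (heatFlow (v s) (t - s) x - oseenDuhamel 1 s v v t x)‖ ≤ ε) ∧
        (∀ x, v (-(c ^ 2)⁻¹) x = c • v (-1) (c • x)) ∧
        (∀ g ∈ G, ∀ t ∈ Set.Icc (-1 : ℝ) (-(c ^ 2)⁻¹), ∀ x, v t (g x) = g (v t x)) ∧
        eLpNorm (v (-1)) 4 volume ≤ ENNReal.ofReal M₀ ∧
        ∃ x₀ : E3, ‖x₀‖ ≤ R₀ ∧ δ₀ ≤ ‖v (-1) x₀‖

/-- **Split A, piece 2 (provable, M): compactness closure.**  Arzelà–Ascoli on the slab × balls (uniform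
Lipschitz bound), bounded local-uniform convergence passes through the heat and Oseen potentials
(dominated convergence with the `L⁴`/amplitude control), the zoom and equivariance identities and weak
solenoidality are closed conditions, Fatou keeps `v(-1) ∈ L⁴`, the floor at `x₀ → x_*` keeps
`v(-1) ≢ 0` (continuity), `SO(3)`-compactness handles the varying conjugate of `T/O/I` and `[c₋,c₊]` the
factor. -/
def CompactnessClosure : Prop := ApproxCells → PolyhedralCell

/-- **Assembly of split A (proved).** -/
theorem crux_of_compactness_split (h₁ : ApproxCells) (h₂ : CompactnessClosure) : Crux :=
  crux_iff_cell.mpr (h₂ h₁)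

/-- **Split B, piece 2 (provable, M): Newton–Kantorovich for quadratic fixed-point equations** `B U U = U`
in a Banach space: an approximate solution `V` with residual `≤ ε`, an inverse bound `K` for the
linearisation `W ↦ W − B V W − B W V`, and `4 K² ‖B‖ ε < 1` give an exact fixed point within `2Kε`. -/
def QuadraticNK : Prop :=
  ∀ (Y : Type) [NormedAddCommGroup Y] [NormedSpace ℝ Y] [CompleteSpace Y]
    (B : Y →L[ℝ] Y →L[ℝ] Y) (V : Y) (L : Y ≃L[ℝ] Y) (ε K : ℝ),
    (∀ W : Y, L W = W - B V W - B W V) → ‖B V V - V‖ ≤ ε → ‖(L.symm : Y →L[ℝ] Y)‖ ≤ K →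
    4 * K ^ 2 * ‖B‖ * ε < 1 → 0 ≤ ε → 0 < K →
    ∃ U : Y, B U U = U ∧ ‖U - V‖ ≤ 2 * K * ε

/-- **Split B, piece 1 (open; carries the crux and more): a CERTIFIED approximate profile** — a Banach
FRAME `(Y, B, ι)` (sector space of `G`-equivariant DSS Type-I fields in the ancient Duhamel form
`U = 𝔅(U,U)` of N21 `stub_ancientDuhamel`, with the dictionary "nonzero fixed points are crux witnesses")
together with the numerical certificate (residual `ε`, inverse bound `K`, `4K²‖B‖ε < 1`, `‖V‖ > 2Kε`). -/
def CertifiedApproximateProfile : Prop :=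
  ∃ (Y : Type) (_ : NormedAddCommGroup Y) (_ : NormedSpace ℝ Y), CompleteSpace Y ∧
    ∃ (B : Y →L[ℝ] Y →L[ℝ] Y) (ι : Y → ℝ → E3 → E3),
      (∀ U : Y, B U U = U → U ≠ 0 →
        ∃ G : Subgroup (E3 ≃ₗᵢ[ℝ] E3), Finite G ∧
          (∀ g ∈ G, LinearMap.det (g.toLinearEquiv : E3 →ₗ[ℝ] E3) = 1) ∧
          (∀ V : Submodule ℝ E3, (∀ g ∈ G, ∀ v ∈ V, g v ∈ V) → V = ⊥ ∨ V = ⊤) ∧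
          ∃ c : ℝ, 1 < c ∧ IsAncientMildSolution 1 (ι U) ∧ (∀ t < 0, AEStronglyMeasurable (ι U t) volume) ∧
            IsDiscretelySelfSimilar c (ι U) ∧ (∃ C₀ : ℝ, HasTypeIDecay C₀ (ι U)) ∧
            (∀ g ∈ G, ∀ t x, ι U t (g x) = g (ι U t x)) ∧ ¬ (∀ t < 0, ι U t =ᵐ[volume] 0)) ∧
      ∃ (V : Y) (L : Y ≃L[ℝ] Y) (ε K : ℝ),
        (∀ W : Y, L W = W - B V W - B W V) ∧ ‖B V V - V‖ ≤ ε ∧ ‖(L.symm : Y →L[ℝ] Y)‖ ≤ K ∧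
        4 * K ^ 2 * ‖B‖ * ε < 1 ∧ 0 ≤ ε ∧ 0 < K ∧ 2 * K * ε < ‖V‖

/-- **Assembly of split B (proved).** -/
theorem crux_of_certificate_split (h₁ : CertifiedApproximateProfile) (h₂ : QuadraticNK) : Crux := by
  obtain ⟨Y, i₁, i₂, i₃, B, ι, hframe, V, L, ε, K, hL, hres, hK, hsmall, hε, hKpos, hV⟩ := h₁
  obtain ⟨U, hfix, hdist⟩ := h₂ Y B V L ε K hL hres hK hsmall hε hKpos
  have hU : U ≠ 0 := by
    intro h0
    rw [h0, zero_sub, norm_neg] at hdist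
    exact absurd (lt_of_lt_of_le hV hdist) (lt_irrefl _)
  obtain ⟨G, hfin, hdet, hirr, c, hc, hanc, hmeas, hdss, hdec, heqv, hnt⟩ := hframe U hfix hU
  exact ⟨G, hfin, hdet, hirr, c, hc, ι U, hanc, hmeas, hdss, hdec, heqv, hnt⟩

end Summit.NavierStokesRegularity.NavierStokesRegularity.Cruxes.PolyhedralDssProfileExists.StrategistS19g2

end
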